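/-
Copyright: the b2b-balaban cell (near-miss cell 7), T⁴-continuum fan-out, lineage t4-ne7b-p3 (node U5c LARGE-DEVIATION
member P3).  Released under the licence of the surrounding project.
-/
import Literature.MathematicalPhysics.QuantumFieldTheory.Balaban1983to89.B16Absorption
import Summits.QuantumFields.BalabanUV.T4Continuum.Support.SpaceTimeRealisedCells

/-!
# Space-time Peierls ∕ Cramér route for NE7b — A REALISED LINEAGE IN THE INDEX MODEL, III: THE CONNECTOR OF A MERGER
# (the merged skeleton is face-connected as soon as the partners' domains touch — reading (R2) reduced to print's
# merger criterion)

Summits-side support leaf of the T⁴-continuum cell (rung (B)+1 on a FINITE torus only; NOT infinite volume, NOT the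
mass gap, NOT the Clay statement; NOT a proof of the spine estimate NE7b).  Lineage `t4-ne7b-p3` (generation 2), node
U5c, skeleton `t4/skeletons/NE7b-t4-ne7b-p3.md` §9 (next kernel step for (R2)).  [folklore] finite combinatorics on
`ℤᵈ` over `SpaceTimeRealised` ∕ `SpaceTimeRealisedCells` (this lineage) and the cell's kernel-checked index model
(`B13ScaleTransfer.{block, collar, FaceConnected, Linked}`, `B16SProfile.{box, Siter_subset_biUnion_box, DropCtl, ratio}`,
`B16Absorption.box_zero`, `TreeLength.treeLen_le_card_sub_one`) — imported BY NAME, nothing modified; nothing is quoted from print here and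
nothing printed is asserted; no `[cite:]` tag.

WHAT.  The realised data predicate `SkelOK` asks, at a merger, that the merged skeleton `piece e ∪ skel X s ∪ skel Y s`
be FACE-CONNECTED (reading (R2)).  This file reduces (R2) to the printed merger criterion — the partners' DOMAINS
intersect or touch (some cell of `dom Y s` lies in the `3^d`-block of some cell of `dom X s`) — by an explicit
CONNECTOR piece:
* §1 geometry: a union of two face-connected sets sharing a point is face-connected (`faceConnected_union_of_mem`); the
  box of radius `r` lies inside the `r`-th collar of its centre (`box_subset_iterate_collar`, by clamping);
* §2 the connector `connector c = box c 63` (`= collar^[63] {c}`, `box_eq_iterate_collar`): face-connected, `127^d` points, tree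
  length `≤ 127^d − 1` (`treeLen_connector_le`);
* §3 under the drop control the domain lies in radius-31 boxes around the skeleton (`exists_skel_near`), so touching
  domains have skeleton points `cX ∈ skel X s`, `cY ∈ skel Y s` with `cY ∈ box cX 63` (`exists_skel_pair_of_touch`);
* §4 with `piece e := connector cX` the merged skeleton at the merger step is face-connected
  (`skel_merge_faceConnected`), and the connector clause of `SkelOK` holds with any `dC ≥ 127^d + 3`
  (`connector_clause`).
So (R2) costs exactly: «the partners' domains intersect or touch at the merger step» + the realisation's choice of the
connector piece (a bookkeeping device whose cells are charged to the volume — harmless for an upper bound).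

HONEST DEPENDENCY (cell, verbatim): continuum YM on T⁴ ⇐ BetaPertH ∧ nine spine estimates (0/9 proved); BetaPertH ⇐
(D1) ∧ (D4) ∧ CAP+tail; G-an2-4 gates asym, D1 and NE2/3/4.  This file changes none of it.
-/

open Finset

namespace Summit.QuantumFields.BalabanUV.T4Continuum.SpaceTimePeierls

open Literature.MathematicalPhysics.QuantumFieldTheory.Balaban1983to89
open Literature.MathematicalPhysics.QuantumFieldTheory.Balaban1983to89.B13ScaleTransfer
open Literature.MathematicalPhysics.QuantumFieldTheory.Balaban1983to89.TreeLength
open Literature.MathematicalPhysics.QuantumFieldTheory.Balaban1983to89.B16SProfile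
open Literature.MathematicalPhysics.QuantumFieldTheory.Balaban1983to89.B16Absorption (box_zero)
open T4PersistenceDictionary

noncomputable section

/-! ## §1 Two geometric facts on `ℤᵈ` -/

section Geometry

variable {d : ℕ}

/-- a union of two face-connected index sets SHARING A POINT is face-connected [folklore] -/
theorem faceConnected_union_of_mem {A B : Finset (Pt d)} (hA : FaceConnected A) (hB : FaceConnected B) {p : Pt d}
    (hpA : p ∈ A) (hpB : p ∈ B) : FaceConnected (A ∪ B) := by
  intro x hx y hy
  rw [mem_union] at hx hy
  have lA : ∀ z ∈ A, Linked (A ∪ B) z p := fun z hz => (hA z hz p hpA).mono subset_union_left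
  have lB : ∀ z ∈ B, Linked (A ∪ B) z p := fun z hz => (hB z hz p hpB).mono subset_union_right
  rcases hx with hx | hx <;> rcases hy with hy | hy
  · exact (lA x hx).trans (lA y hy).symm
  · exact (lA x hx).trans (lB y hy).symm
  · exact (lB x hx).trans (lA y hy).symm
  · exact (lB x hx).trans (lB y hy).symm

/-- **THE BOX OF RADIUS `r` LIES IN THE `r`-TH COLLAR OF ITS CENTRE** (clamp a point of `box c (r+1)` into `box c r`;
it moves by at most one in every coordinate). [folklore] -/
theorem box_subset_iterate_collar (c : Pt d) : ∀ r : ℕ, box c r ⊆ collar^[r] {c}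
  | 0 => by rw [box_zero]; exact subset_rfl
  | r + 1 => by
      intro y hy
      rw [mem_box] at hy
      rw [Function.iterate_succ_apply', mem_collar]
      -- the clamped point
      refine ⟨fun i => max (c i - r) (min (c i + r) (y i)), box_subset_iterate_collar c r ?_, ?_⟩
      · rw [mem_box]
        intro i
        have := hy i
        push_cast at this ⊢
        constructor
        · exact le_max_left _ _
        · exact max_le (by omega) (min_le_left _ _)
      · rw [mem_block]
        intro i
        have := hy i
        push_cast at this
        constructor
        · rcases le_total (c i - r) (min (c i + r) (y i)) with h | h
          · rw [max_eq_right h]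
            have := min_le_right (c i + ↑r) (y i)
            rcases le_total (c i + r) (y i) with h' | h'
            · rw [min_eq_left h']; omega
            · rw [min_eq_right h']; omega
          · rw [max_eq_left h]
            have h2 : min (c i + ↑r) (y i) ≤ c i - r := h
            rcases le_total (c i + r) (y i) with h' | h'
            · rw [min_eq_left h'] at h2; omega
            · rw [min_eq_right h'] at h2; omega
        · rcases le_total (c i - r) (min (c i + r) (y i)) with h | h
          · rw [max_eq_right h]
            rcases le_total (c i + r) (y i) with h' | h'
            · rw [min_eq_left h']; omega
            · rw [min_eq_right h']; omega
          · rw [max_eq_left h]; omega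

end Geometry

/-! ## §2 The connector -/

section Connector

variable {d : ℕ}

/-- the box of radius `r` IS the `r`-th collar of its centre [folklore] -/
theorem box_eq_iterate_collar (c : Pt d) (r : ℕ) : box c r = collar^[r] {c} := by
  refine Subset.antisymm (box_subset_iterate_collar c r) ?_
  have h := iterate_collar_box_subset c 0 r
  rwa [box_zero, Nat.zero_add] at h

/-- boxes are face-connected (a singleton is, and collars preserve face-connectedness) [folklore] -/
theorem faceConnected_box (c : Pt d) (r : ℕ) : FaceConnected (box c r) := by
  rw [box_eq_iterate_collar]
  refine faceConnected_iterate_collar r fun x hx y hy => ?_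
  rw [mem_singleton] at hx hy
  subst hx; subst hy
  exact Relation.ReflTransGen.refl

/-- **THE CONNECTOR** about an index point: the box of radius `63` (a face-connected blob reaching every point within
sup-distance `63`). [folklore] -/
def connector (c : Pt d) : Finset (Pt d) := box c 63

/-- the connector is face-connected [folklore] -/
theorem faceConnected_connector (c : Pt d) : FaceConnected (connector c) := faceConnected_box c 63

/-- the connector contains its centre [folklore] -/
theorem mem_connector_self (c : Pt d) : c ∈ connector c := mem_box_self c 63

/-- the connector is nonempty [folklore] -/
theorem connector_nonempty (c : Pt d) : (connector c).Nonempty := ⟨c, mem_connector_self c⟩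

/-- the connector has `127^d` points [folklore] -/
theorem card_connector (c : Pt d) : (connector c).card = 127 ^ d := by
  rw [connector, card_box]

/-- **THE CONNECTOR HAS BOUNDED TREE LENGTH**: `treeLen (connector c) ≤ 127^d − 1`. [folklore] -/
theorem treeLen_connector_le (c : Pt d) : treeLen (connector c) ≤ (127 : ℝ) ^ d - 1 := by
  have h := treeLen_le_card_sub_one (connector_nonempty c) (faceConnected_connector c)
  have hc : ((connector c).card : ℝ) = (127 : ℝ) ^ d := by rw [card_connector]; push_cast; ring
  linarith

end Connector

/-! ## §3 Touching domains have nearby skeleton points -/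

section Near

variable {d : ℕ} {ε : Type*} [DecidableEq ε] {step : ε → ℕ} {piece : ε → Finset (Pt d)} {L : ℕ} {σ : ℕ → ℕ}
  {m : ℕ}

/-- under the drop control every cell of the realised domain lies in the radius-31 box of a skeleton point
(`B16SProfile.Siter_subset_biUnion_box` per piece) [folklore] -/
theorem exists_skel_near (hL : 3 ≤ L) (h : DropCtl σ m) (G : Gen ε) {n : ℕ} (hev : ∀ e ∈ G.events, step e ≤ n)
    (hn : n ≤ m) {x : Pt d} (hx : x ∈ dom (ratio L σ) step piece G n) :
    ∃ c ∈ skel (ratio L σ) step piece G n, x ∈ box c 31 := by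
  classical
  unfold dom at hx
  rw [mem_biUnion] at hx
  obtain ⟨e, he, hxe⟩ := hx
  have hse := hev e he
  have hsub : iterAt (ratio L σ) (step e) n (piece e) ⊆
      (coverAt (ratio L σ) (step e) n (piece e)).biUnion fun c => box c 31 := by
    unfold iterAt coverAt Qs
    rw [ratio_shift]
    exact Siter_subset_biUnion_box hL (dropCtl_shift h (step e)) (piece e) (by omega)
  obtain ⟨c, hc, hxc⟩ := mem_biUnion.1 (hsub hxe)
  exact ⟨c, mem_biUnion.2 ⟨e, he, hc⟩, hxc⟩

/-- **TOUCHING DOMAINS HAVE SKELETON POINTS WITHIN RADIUS `63`**: if a cell `y` of `dom Y s` lies in the `3^d`-block of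
a cell `x` of `dom X s` (the domains intersect or touch), then some `cY ∈ skel Y s` lies in `box cX 63` for some
`cX ∈ skel X s`. [folklore] -/
theorem exists_skel_pair_of_touch (hL : 3 ≤ L) (h : DropCtl σ m) (X Y : Gen ε) {s : ℕ}
    (hX : ∀ e ∈ X.events, step e ≤ s) (hY : ∀ e ∈ Y.events, step e ≤ s) (hs : s ≤ m) {x y : Pt d}
    (hx : x ∈ dom (ratio L σ) step piece X s) (hy : y ∈ dom (ratio L σ) step piece Y s) (hxy : y ∈ block x) :
    ∃ cX ∈ skel (ratio L σ) step piece X s, ∃ cY ∈ skel (ratio L σ) step piece Y s, cY ∈ box cX 63 := by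
  obtain ⟨cX, hcX, hxX⟩ := exists_skel_near hL h X hX hs hx
  obtain ⟨cY, hcY, hyY⟩ := exists_skel_near hL h Y hY hs hy
  refine ⟨cX, hcX, cY, hcY, ?_⟩
  rw [mem_box] at hxX hyY ⊢
  rw [mem_block] at hxy
  intro i
  have h1 := hxX i
  have h2 := hyY i
  have h3 := hxy i
  push_cast at h1 h2 ⊢
  constructor <;> omega

end Near

/-! ## §4 The merged skeleton with the connector piece -/

section Merge

variable {d : ℕ} {ε : Type*} [DecidableEq ε] {q : ℕ → ℕ} {step : ε → ℕ} {piece : ε → Finset (Pt d)}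

/-- **WITH THE CONNECTOR AS THE MERGER'S PIECE THE MERGED SKELETON IS FACE-CONNECTED**: if the partners' skeletons at
the merger step are face-connected, `cX ∈ skel X (step e)`, `cY ∈ skel Y (step e)` with `cY ∈ box cX 63`, and
`piece e = connector cX`, then `skel (merge X Y e) (step e)` is face-connected — the (R2) clause of `SkelOK`. [folklore] -/
theorem skel_merge_faceConnected {X Y : Gen ε} {e : ε}
    (hXfc : FaceConnected (skel q step piece X (step e))) (hYfc : FaceConnected (skel q step piece Y (step e)))
    {cX cY : Pt d} (hcX : cX ∈ skel q step piece X (step e)) (hcY : cY ∈ skel q step piece Y (step e))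
    (hnear : cY ∈ box cX 63) (hpiece : piece e = connector cX) :
    FaceConnected (skel q step piece (Gen.merge X Y e) (step e)) := by
  rw [skel_merge_self, hpiece, ← union_assoc]
  have h1 : FaceConnected (connector cX ∪ skel q step piece X (step e)) :=
    faceConnected_union_of_mem (faceConnected_connector cX) hXfc (mem_connector_self cX) hcX
  exact faceConnected_union_of_mem h1 hYfc (mem_union_left _ (show cY ∈ connector cX from hnear)) hcY

omit [DecidableEq ε] in
/-- … and the connector clause of `SkelOK` holds for it with any `dC ≥ 127^d + 3`. [folklore] -/
theorem connector_clause {e : ε} {cX : Pt d} (hpiece : piece e = connector cX) {dC : ℝ}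
    (hdC : (127 : ℝ) ^ d + 3 ≤ dC) :
    (piece e = ∅ ∨ FaceConnected (piece e)) ∧ treeLen (piece e) + 4 ≤ dC := by
  rw [hpiece]
  refine ⟨Or.inr (faceConnected_connector cX), ?_⟩
  have := treeLen_connector_le cX
  linarith

/-- **(R2) FROM THE PRINTED MERGER CRITERION** — packaged: under the drop control (`L ≥ 3`, merger step `≤ m`), if the
partners' skeletons at the merger step are face-connected (as `SpaceTimeRealised.treeLen_skel_le` provides) and the
partners' DOMAINS touch, there is a skeleton point `cX` such that choosing the merger's piece as `connector cX` makes the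
merged skeleton face-connected and satisfies the connector clause with `dC ≥ 127^d + 3`. [folklore] -/
theorem exists_connector_of_touch {L : ℕ} {σ : ℕ → ℕ} {m : ℕ} (hL : 3 ≤ L) (h : DropCtl σ m) (X Y : Gen ε)
    (e : ε) (hXev : ∀ e' ∈ X.events, step e' ≤ step e) (hYev : ∀ e' ∈ Y.events, step e' ≤ step e)
    (hs : step e ≤ m) (hXfc : FaceConnected (skel (ratio L σ) step piece X (step e)))
    (hYfc : FaceConnected (skel (ratio L σ) step piece Y (step e))) {x y : Pt d}
    (hx : x ∈ dom (ratio L σ) step piece X (step e)) (hy : y ∈ dom (ratio L σ) step piece Y (step e))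
    (hxy : y ∈ block x) :
    ∃ cX ∈ skel (ratio L σ) step piece X (step e),
      ∀ piece' : ε → Finset (Pt d), (∀ e' ∈ X.events, piece' e' = piece e') → (∀ e' ∈ Y.events, piece' e' = piece e') →
        piece' e = connector cX →
          FaceConnected (skel (ratio L σ) step piece' (Gen.merge X Y e) (step e)) := by
  obtain ⟨cX, hcX, cY, hcY, hnear⟩ := exists_skel_pair_of_touch hL h X Y hXev hYev hs hx hy hxy
  refine ⟨cX, hcX, fun piece' hpX hpY hpe => ?_⟩
  -- the partners' skeletons do not change when only the merger's piece is set
  have hsX : skel (ratio L σ) step piece' X (step e) = skel (ratio L σ) step piece X (step e) :=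
    Finset.biUnion_congr rfl fun e' he' => by rw [hpX e' he']
  have hsY : skel (ratio L σ) step piece' Y (step e) = skel (ratio L σ) step piece Y (step e) :=
    Finset.biUnion_congr rfl fun e' he' => by rw [hpY e' he']
  refine skel_merge_faceConnected (q := ratio L σ) (piece := piece') (by rw [hsX]; exact hXfc)
    (by rw [hsY]; exact hYfc) (by rw [hsX]; exact hcX) (by rw [hsY]; exact hcY) hnear hpe

end Merge

end

end Summit.QuantumFields.BalabanUV.T4Continuum.SpaceTimePeierls
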